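import Summits.NavierStokesRegularity.FunctionalMining.Candidates
import HarnessLib

/-!
# FunctionalMining — strain moments `∫|S|^q` typed (K0 family `ES.absS`; NOGO N8 / K0-FLAGS A5) (dict seat, staged)

Search for candidate a priori estimates; no regularity claim.

STAGED FILE (planner/dict seat cannot file under `FunctionalMining/`; the prove seat files it as
`FunctionalMining/StrainMoment.lean`). Dictionary typing only — no analysis beyond pointwise algebra:

* `torusStrainSqAt v x = ∑ᵢⱼ (((∂ⱼv)ᵢ + (∂ᵢv)ⱼ)/2)² = |S(x)|²_F`, the squared Frobenius norm of the
  strain-rate matrix (character-for-character the integrand of the tree's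
  `integral_strainNormSq_eq_torusEnstrophy`, Miller Prop. 3.1 / Ayala–Protas (2.4));
* the pointwise Pythagoras `|S|² + ½|ω|² = |∇v|²_F` (`torusStrainSqAt_add_half_torusVorticitySqAt`,
  with the tree's orientation-free `torusVorticitySqAt`), hence `|S|² ≤ |∇v|²_F` pointwise;
* `torusStrainMoment q v = ∫ |S|^q := ∫ (torusStrainSqAt v x)^{q/2}` (K0 core family `ES.absS.q`),
  `torusStrainMoment 2 v = ℰ(v)` for smooth divergence-free `v` (`torusStrainMoment_two`);
* the K0 rows as named statements in the cell's majorant form (no supremum, no junk):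
  `StrainMomentRateSupBound q C` (row `ES.absS.q|T_C|C1`: `d/dt ∫|S|^q ≤ C ‖ω‖_∞ ∫|S|^q`),
  `StrainMomentLogBudget q j C c` (rows `ES.absS.q|T_CL|C1|j`), and NOGO N8 = K0-FLAGS A5 as ONE
  statement `StrainMomentCZClosure : ∀ q ∈ (1, ∞), ∃ C, StrainMomentRateSupBound q C` — marked
  `@[conjecture]` here because its paper proof (NOGO.md N8: `|∇u| ≤ κ_q`-Calderón–Zygmund in `L^q`,
  `|∇²p|_q ≲ |∇u|²_{2q}`, convexity of `|·|^q` for the viscous term) uses `L^q` facts not yet in the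
  tree (the lit seat's `TorusGradientVorticityLp` is the first of them);
* the two implications the census bookkeeping needs, PROVED: `T_C ⇒ T_CL` for every `j`
  (`strainMomentLogBudget_of_rateSupBound`, the log factor is `≥ 1`) — this is exactly the K0-FLAGS A5
  reclassification "the `T_CL|C1` rows of `ES.absS` are dominated by the `T_C|C1` row" — and the
  calibration `StrainMomentRateSupBound 2 2` (`strainMomentRateSupBound_two`, from Doering–Gibbon's
  `dℰ/dt ≤ 2‖ω‖_∞ℰ` in the tree and `∫|S|² = ℰ`), so the row `ES.absS.q=2|T_C|C1` is a control in Lean.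

Nothing here is a regularity statement: every `def … : Prop` below is an a priori inequality along
classical solutions whose multiplier `‖ω‖_∞` is the Beale–Kato–Majda quantity; closing any of them
under `∫‖ω‖_∞ dt < ∞` re-derives BKM and nothing more (K0 `closing` column).
-/

noncomputable section

open Set MeasureTheory
open scoped InnerProductSpace RealInnerProductSpace

namespace Summit.NavierStokesRegularity.FunctionalMining

open Literature.Analysis.FunctionSpaces Literature.Analysis.FluidPDE

variable {d : Type*} [Fintype d] [DecidableEq d]

/-! ## The pointwise strain magnitude -/

/-- `|S(x)|²_F := ∑ᵢⱼ (((∂ⱼv)ᵢ(x) + (∂ᵢv)ⱼ(x))/2)²`, the squared Frobenius norm of the strain-rate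
matrix `S = ½(∇v + ∇vᵀ)`; junk `0` where `v` is not differentiable (`Torus.partialDeriv`).
K0 local density `absS^2`. [folklore] -/
def torusStrainSqAt (v : UnitAddTorus d → EuclideanSpace ℝ d) (x : UnitAddTorus d) : ℝ :=
  ∑ i, ∑ j, ((Torus.partialDeriv j v x i + Torus.partialDeriv i v x j) / 2) ^ 2

/-- `|S(x)|² ≥ 0`. [folklore] -/
theorem torusStrainSqAt_nonneg (v : UnitAddTorus d → EuclideanSpace ℝ d) (x : UnitAddTorus d) :
    0 ≤ torusStrainSqAt v x :=
  Finset.sum_nonneg fun _ _ => Finset.sum_nonneg fun _ _ => sq_nonneg _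

/-- **Pointwise Pythagoras `|S|² + ½|ω|² = |∇v|²_F`:**
`torusStrainSqAt v x + ½ · torusVorticitySqAt v x = ∑ᵢ ‖∂ᵢv(x)‖²` — the symmetric/antisymmetric
splitting of `∇v` is Frobenius-orthogonal (`torusVorticitySqAt = ½∑ᵢⱼ((∂ᵢv)ⱼ − (∂ⱼv)ᵢ)²` is the
squared norm of the antisymmetric part). Pure algebra, every dimension, no divergence condition.
[folklore] -/
theorem torusStrainSqAt_add_half_torusVorticitySqAt (v : UnitAddTorus d → EuclideanSpace ℝ d)
    (x : UnitAddTorus d) :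
    torusStrainSqAt v x + 2⁻¹ * torusVorticitySqAt v x = ∑ i, ‖Torus.partialDeriv i v x‖ ^ 2 := by
  have hnorm : ∀ i, ‖Torus.partialDeriv i v x‖ ^ 2 = ∑ j, Torus.partialDeriv i v x j ^ 2 := by
    intro i
    rw [EuclideanSpace.norm_sq_eq]
    exact Finset.sum_congr rfl fun j _ => by rw [Real.norm_eq_abs, sq_abs]
  simp_rw [hnorm]
  unfold torusStrainSqAt torusVorticitySqAt
  have hswap : ∑ i, ∑ j, Torus.partialDeriv j v x i ^ 2 = ∑ i, ∑ j, Torus.partialDeriv i v x j ^ 2 :=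
    Finset.sum_comm
  have hexpS : ∑ i, ∑ j, ((Torus.partialDeriv j v x i + Torus.partialDeriv i v x j) / 2) ^ 2 =
      ∑ i, ∑ j, (4⁻¹ * Torus.partialDeriv j v x i ^ 2 + 4⁻¹ * Torus.partialDeriv i v x j ^ 2 +
        2⁻¹ * (Torus.partialDeriv j v x i * Torus.partialDeriv i v x j)) :=
    Finset.sum_congr rfl fun i _ => Finset.sum_congr rfl fun j _ => by ring
  have hexpW : ∑ i, ∑ j, (Torus.partialDeriv i v x j - Torus.partialDeriv j v x i) ^ 2 =
      ∑ i, ∑ j, (Torus.partialDeriv i v x j ^ 2 + Torus.partialDeriv j v x i ^ 2 -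
        2 * (Torus.partialDeriv j v x i * Torus.partialDeriv i v x j)) :=
    Finset.sum_congr rfl fun i _ => Finset.sum_congr rfl fun j _ => by ring
  rw [hexpS, hexpW]
  simp only [Finset.sum_add_distrib, Finset.sum_sub_distrib, ← Finset.mul_sum]
  rw [hswap]
  ring

/-- `|S(x)|² ≤ |∇v(x)|²_F = ∑ᵢ ‖∂ᵢv(x)‖²` (drop the vorticity square). [folklore] -/
theorem torusStrainSqAt_le_sum_norm_sq (v : UnitAddTorus d → EuclideanSpace ℝ d) (x : UnitAddTorus d) :
    torusStrainSqAt v x ≤ ∑ i, ‖Torus.partialDeriv i v x‖ ^ 2 := by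
  rw [← torusStrainSqAt_add_half_torusVorticitySqAt v x]
  exact le_add_of_nonneg_right (mul_nonneg (by norm_num) (torusVorticitySqAt_nonneg v x))

/-- `½|ω(x)|² ≤ |∇v(x)|²_F` read off the same identity (the tree's
`torusVorticitySqAt_le_two_mul_sum_norm_sq`, re-derived). [folklore] -/
theorem half_torusVorticitySqAt_le_sum_norm_sq (v : UnitAddTorus d → EuclideanSpace ℝ d)
    (x : UnitAddTorus d) :
    2⁻¹ * torusVorticitySqAt v x ≤ ∑ i, ‖Torus.partialDeriv i v x‖ ^ 2 := by
  rw [← torusStrainSqAt_add_half_torusVorticitySqAt v x]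
  exact le_add_of_nonneg_left (torusStrainSqAt_nonneg v x)

/-! ## The strain moments `∫|S|^q` -/

/-- The strain moment `∫_{T^d} |S|^q := ∫ (torusStrainSqAt v x)^{q/2}` (real power; K0 core family
`ES.absS.q`, `q ∈ {3/2, 2, 3, 4, …}`). Bochner integral, junk `0` if not integrable; on the unit torus
its time dimension is `T^{−q}`, so `∫|S|^q / ν^q` is the dimensionless amplitude. [folklore] -/
def torusStrainMoment (q : ℝ) (v : UnitAddTorus d → EuclideanSpace ℝ d) : ℝ :=
  ∫ x, torusStrainSqAt v x ^ (q / 2)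

/-- `∫|S|^q ≥ 0`. [folklore] -/
theorem torusStrainMoment_nonneg (q : ℝ) (v : UnitAddTorus d → EuclideanSpace ℝ d) :
    0 ≤ torusStrainMoment q v :=
  integral_nonneg fun x => Real.rpow_nonneg (torusStrainSqAt_nonneg v x) _

/-- **`∫|S|² = ℰ`** for smooth divergence-free fields: `torusStrainMoment 2 v = torusEnstrophy v`
(the tree's `integral_strainNormSq_eq_torusEnstrophy`, Miller Prop. 3.1 at `α = 0`). [folklore] -/
theorem torusStrainMoment_two {v : UnitAddTorus d → EuclideanSpace ℝ d} (hv : Torus.IsSmooth v)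
    (hdiv : Torus.IsDivFree v) : torusStrainMoment 2 v = torusEnstrophy v := by
  unfold torusStrainMoment
  have h2 : (2 : ℝ) / 2 = 1 := by norm_num
  simp only [h2, Real.rpow_one]
  exact integral_strainNormSq_eq_torusEnstrophy hv hdiv

/-! ## The K0 rows of family `ES.absS` as named statements -/

/-- **K0 row `ES.absS.q|T_C|C1` (conditional linear budget against `‖ω‖_∞`).** Along every classical
solution of unforced Navier–Stokes/Euler (`ν ≥ 0`) on `T³ × [a, b]`, at every time `t` and for every
pointwise vorticity majorant `M` (`|ω(t,x)|² ≤ M²`), every one-sided derivative value `R` of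
`s ↦ ∫|S(u s)|^q` within `[a, b]` at `t` satisfies `R ≤ C·M·∫|S(u t)|^q`. Majorant form of
`DoeringGibbon1995_enstrophyRate_le_vorticitySup` with `ℰ` replaced by `∫|S|^q`. PROVED below at
`q = 2, C = 2`; for `1 < q < ∞` it is NOGO N8 (paper level, `StrainMomentCZClosure`); closing it under
`∫‖ω‖_∞ < ∞` only re-derives Beale–Kato–Majda (K0 `closing`: "BKM makes it uninformative").
Search for candidate a priori estimates; no regularity claim — nothing is asserted. -/
@[conjecture] def StrainMomentRateSupBound (q C : ℝ) : Prop :=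
  Fintype.card d = 3 → ∀ {ν : ℝ}, 0 ≤ ν → ∀ {a b : ℝ}, a < b →
    ∀ {u : ℝ → UnitAddTorus d → EuclideanSpace ℝ d} {p : ℝ → UnitAddTorus d → ℝ},
      Torus.IsClassicalNSSolutionOn (Icc a b) ν 0 u p →
      ∀ t ∈ Icc a b, ∀ M : ℝ, 0 ≤ M → (∀ x, torusVorticitySqAt (u t) x ≤ M ^ 2) →
        ∀ R : ℝ, HasDerivWithinAt (fun s => torusStrainMoment q (u s)) R (Icc a b) t →
          R ≤ C * M * torusStrainMoment q (u t)

/-- **K0 rows `ES.absS.q|T_CL|C1|j` (log-Grönwall/Osgood shape, door D4).** As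
`StrainMomentRateSupBound` but for `ν > 0` and with the slowly varying factor
`log^j(e + c·∫|S|^q/ν^q)` (unit-torus nondimensionalisation; K0's `F̂` additionally carries a power of
the energy, immaterial here since every `T_CL` row is dominated by the `T_C` row, next lemma).
`j = 1` rows are Osgood-closable candidates, `j = 2` rows measurements (K0 `shapes.T_CL`).
Search for candidate a priori estimates; no regularity claim — nothing is asserted. -/
@[conjecture] def StrainMomentLogBudget (q : ℝ) (j : ℕ) (C c : ℝ) : Prop :=
  Fintype.card d = 3 → ∀ {ν : ℝ}, 0 < ν → ∀ {a b : ℝ}, a < b →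
    ∀ {u : ℝ → UnitAddTorus d → EuclideanSpace ℝ d} {p : ℝ → UnitAddTorus d → ℝ},
      Torus.IsClassicalNSSolutionOn (Icc a b) ν 0 u p →
      ∀ t ∈ Icc a b, ∀ M : ℝ, 0 ≤ M → (∀ x, torusVorticitySqAt (u t) x ≤ M ^ 2) →
        ∀ R : ℝ, HasDerivWithinAt (fun s => torusStrainMoment q (u s)) R (Icc a b) t →
          R ≤ C * M * torusStrainMoment q (u t) *
            Real.log (Real.exp 1 + c * torusStrainMoment q (u t) / ν ^ q) ^ j

/-- **NOGO N8 = K0-FLAGS A5, typed (paper-level theorem of the no-go seat, UNREVIEWED; `@[conjecture]`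
here until its `L^q` inputs are tree facts): the Calderón–Zygmund closure of the strain-moment rows.**
For every `1 < q < ∞` there is `C = C(q)` with `StrainMomentRateSupBound q C` — literally the statement
NOGO.md v5 (N8, "N8 is not typed … a statement would be `∀ q ∈ (1,∞), ∃ C, StrainMomentRateSupBound q C`")
asks for. Paper proof (NOGO.md N8): with `A = ∇u = S + Ω̂`, `Π = ∇²p`,
`∂ₜS + u·∇S = −(S² + Ω̂²)_sym − Π + νΔS`, so `d/dt ∫|S|^q = N_q − D_q`, `D_q ≥ 0` (convexity of `|·|^q`),
`N_q = −q∫|S|^{q−2} S:(S² + Ω̂² + Π)`; three Hölder lines put the sup on ONE vorticity factor: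
`∫|S|^{q+1} ≤ ‖∇u‖_{q+1}^{q+1} ≤ κ_{q+1}^{q+1}‖ω‖_∞‖ω‖_q^q ≤ κ_{q+1}^{q+1}(√2 K_q)^q ‖ω‖_∞ ∫|S|^q`,
`∫|S|^{q−1}|Ω̂²| ≤ ½‖ω‖_∞ ∫|S|^{q−1}|ω|`, and the pressure Hessian in `L^{(q+1)/2}` (not `L^∞`):
`∫|S|^{q−1}|Π| ≤ ‖S‖_{q+1}^{q−1} ρ_{(q+1)/2} ‖|∇u|²‖_{(q+1)/2}` — `κ_p, K_p, ρ_r` the `L^p(T³)` Calderón–Zygmund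
constants of `ω ↦ ∇u`, `S ↦ ∇u`, `f ↦ ∇²Δ⁻¹f`, finite for `1 < p, r < ∞` and not explicit
[Majda–Bertozzi 2002, Prop. 10.6]; the endpoints `q = 1, ∞` are excluded (CZ fails). The tree has the
`p = 2` isometries (`TorusStrainVorticityIsometry`) and, pending, the lit seat's `TorusGradientVorticityLp`
(`κ_p`); `K_p`, `ρ_r` and the `∫|S|^q` balance along classical solutions are not yet tree lemmas.
Search for candidate a priori estimates; no regularity claim — nothing is asserted. -/
@[conjecture] def StrainMomentCZClosure : Prop :=
  ∀ q : ℝ, 1 < q → ∃ C : ℝ, StrainMomentRateSupBound (d := d) q C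

/-! ## Proved bookkeeping: `T_C ⇒ T_CL` (A5) and the calibration `q = 2` -/

/-- `1 ≤ log (e + y)` for `y ≥ 0` (kept `private`: an identical statement is landed in
`Literature.Barriers.NavierStokesRegularity.InstantaneousTypeIBlowupDecomposition`). [folklore] -/
private theorem one_le_log_exp_one_add' {y : ℝ} (hy : 0 ≤ y) : 1 ≤ Real.log (Real.exp 1 + y) := by
  have he : 0 < Real.exp 1 := Real.exp_pos 1
  calc (1 : ℝ) = Real.log (Real.exp 1) := (Real.log_exp 1).symm
    _ ≤ Real.log (Real.exp 1 + y) := Real.log_le_log he (le_add_of_nonneg_right hy)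

/-- **A5 in Lean: every `T_CL|C1|j` row of `ES.absS.q` is dominated by the `T_C|C1` row** — for
`C, c ≥ 0` the log factor is `≥ 1`, so `StrainMomentRateSupBound q C → StrainMomentLogBudget q j C c`
for every `j`. Hence once N8 (`StrainMomentCZClosure`) is a theorem, all `2 × 2` log rows of each
`ES.absS.q`, `1 < q < ∞`, are controls (K0-FLAGS v0.2 flag A5). [folklore] -/
theorem strainMomentLogBudget_of_rateSupBound {q C c : ℝ} {j : ℕ}
    (h : StrainMomentRateSupBound (d := d) q C) (hC : 0 ≤ C) (hc : 0 ≤ c) :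
    StrainMomentLogBudget (d := d) q j C c := by
  intro hd ν hν a b hab u p hsol t ht M hM hω R hR
  have hF : 0 ≤ torusStrainMoment q (u t) := torusStrainMoment_nonneg q (u t)
  have hlog : 1 ≤ Real.log (Real.exp 1 + c * torusStrainMoment q (u t) / ν ^ q) :=
    one_le_log_exp_one_add' (div_nonneg (mul_nonneg hc hF) (Real.rpow_nonneg hν.le q))
  have hpow : (1 : ℝ) ≤ Real.log (Real.exp 1 + c * torusStrainMoment q (u t) / ν ^ q) ^ j :=
    one_le_pow₀ hlog
  have h0 : 0 ≤ C * M * torusStrainMoment q (u t) := mul_nonneg (mul_nonneg hC hM) hF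
  calc R ≤ C * M * torusStrainMoment q (u t) := h hd hν.le hab hsol t ht M hM hω R hR
    _ = C * M * torusStrainMoment q (u t) * 1 := (mul_one _).symm
    _ ≤ C * M * torusStrainMoment q (u t) *
          Real.log (Real.exp 1 + c * torusStrainMoment q (u t) / ν ^ q) ^ j :=
        mul_le_mul_of_nonneg_left hpow h0

/-- **Calibration (PROVED): `StrainMomentRateSupBound 2 2`** — along a classical solution
`∫|S(u s)|² = ℰ(u s)` at every `s ∈ [a, b]` (`torusStrainMoment_two`), so a derivative value of
`s ↦ ∫|S(u s)|²` within `[a, b]` is one of `s ↦ ℰ(u s)`, and Doering–Gibbon's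
`dℰ/dt ≤ 2‖ω‖_∞ℰ` (`DoeringGibbon1995_enstrophyRate_le_vorticitySup_holds`) applies. The K0 row
`ES.absS.q=2|T_C|C1` is therefore a control in Lean (it was one on paper: `∫|S|² = ℰ`). [folklore] -/
theorem strainMomentRateSupBound_two : StrainMomentRateSupBound (d := d) 2 2 := by
  intro hd ν hν a b hab u p hsol t ht M hM hω R hR
  have heq : ∀ s ∈ Icc a b, torusEnstrophy (u s) = torusStrainMoment 2 (u s) := fun s hs =>
    (torusStrainMoment_two (hsol.smooth_velocity.isSmooth_slice hs) (hsol.divFree s hs)).symm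
  have hR' : HasDerivWithinAt (fun s => torusEnstrophy (u s)) R (Icc a b) t :=
    hR.congr_of_mem heq ht
  have h := DoeringGibbon1995_enstrophyRate_le_vorticitySup_holds (d := d) hd hν hab hsol t ht M hM hω R hR'
  rw [← heq t ht]
  exact h

end Summit.NavierStokesRegularity.FunctionalMining
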